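import Literature.NumberTheory.LFunctions.RayClassesColonIdeal
import Literature.NumberTheory.GaloisRepresentations.HeckeCharacterValueFieldProofs
import HarnessLib

/-!
# `|φ(𝔞)|² = N𝔞` for a Größencharakter of type `(1, 0)` of an imaginary quadratic field
# (de Shalit 1987, II.1.1 / II.3.5: `φ φ̄ = N`, so `L(φ̄^k, k; 𝔠) = Σ_{𝔞∼𝔠} φ(𝔞)^{−k}`)

Topic `Literature/NumberTheory/LFunctions`; namespace `Literature.NumberTheory.LFunctions`, sequel of
`RayClassesColonIdeal.lean` (the currency "`ψ̃ = idealPow K ψ` of type `ιK` on the ray mod `𝔪`":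
`ψ̃((b))·ιK(c) = ψ̃((c))·ιK(b)` for nonzero `b ≡ c mod 𝔪`, `c` prime to `𝔪` — de Shalit's
`φ((α)) = α`, `α ≡ 1 mod* 𝔪`). Theorems only; no definition, no named fact.

For an imaginary quadratic `K` (`[K:ℚ] = 2`, no real place) with complex embedding `ιK`, a modulus
`𝔪 ≠ 0`, and such a `ψ̃` nonvanishing at the primes not dividing `𝔪`, every nonzero ideal `𝔞` prime to
`𝔪` has **`ψ̃(𝔞)·conj ψ̃(𝔞) = N𝔞`** (`idealPow_mul_conj_eq_absNorm`; also `‖ψ̃(𝔞)‖² = N𝔞`,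
`conj ψ̃(𝔞) = N𝔞/ψ̃(𝔞)`). This is the dictionary `φ̄ = N/φ` between de Shalit's partial `L`-value
`L(φ̄^k, k; (K(𝔪)/K, 𝔠)) = Σ_{𝔞∼𝔠} φ̄(𝔞)^k N𝔞^{−k}` in II.3.5 (13) and the lattice sum `Σ_{𝔞∼𝔠} φ(𝔞)^{−k}`
of `EisensteinNumbersPartialHeckeL.lean` (de Shalit II.1.1: "`φ φ̄ = N` for a character of type
`(1,0)`"; Weil: a character of type `(A₀)` and weight `w` has `|χ(𝔞)| = N𝔞^{w/2}`). Proof: some power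
`𝔞^m` lies in the unit ray class (`HeckeCharacter.exists_pos_rayClassRel_top_pow`: `(c)𝔞^m = (b)`,
`b ≡ c mod 𝔪`), so `ψ̃(𝔞)^m = ιK(b)/ιK(c)` (`idealPow_eq_mul_of_span_mul_eq`) and
`|ιK(b)|² = N((b))` in an imaginary quadratic field (`sq_norm_embedding_eq_absNorm`), whence
`(|ψ̃(𝔞)|²)^m = (N𝔞)^m`.

NOT here: the general CM-type statement `|ψ̃(𝔞)|² = N𝔞^w` for `IsGrossencharakter 𝔪 p q ψ` with
`p_w + q_w = w` over a totally complex field (same proof with `absNorm_span_singleton_eq_prod`).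
`-- TODO(general form): weight-w Größencharaktere over CM fields.`

References: E. de Shalit (1987), II.1.1 (p. 32–33), II.3.5 (13) (p. 54) [deShalit1987]; J. Neukirch,
*Algebraic Number Theory* (1999), VII §6 (6.13)–(6.14), III §1 [NeukirchANT1999].

Mathlib / tree search: Mathlib `InfinitePlace.prod_eq_abs_norm`, `IsTotallyComplex.finrank`,
`card_eq_nrRealPlaces_add_nrComplexPlaces`, `Fintype.prod_subsingleton`, `Complex.mul_conj`,
`pow_left_inj₀`; tree `HeckeCharacter.exists_pos_rayClassRel_top_pow`, `idealPow_eq_mul_of_span_mul_eq`,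
`idealPow_ne_zero_of_isCoprime`, `idealPow_top`, `idealPow_pow`, `absNorm_span_singleton_eq_prod`
(`lean search 'norm_idealPow|idealPow_mul_conj|normSq_idealPow'`: only `|χ(𝔞)| = 1` for ray class characters).
-/

noncomputable section

open scoped nonZeroDivisors ComplexConjugate
open NumberField NumberField.InfinitePlace IsDedekindDomain
open Literature.NumberTheory.GaloisRepresentations

namespace Literature.NumberTheory.LFunctions

variable {K : Type} [Field K] [NumberField K]

/-! ### §1. Imaginary quadratic fields: one infinite place, `N((b)) = |ιK b|²` -/

/-- An imaginary quadratic field has exactly one infinite place. [cite: NeukirchANT1999, Ch. III §1] -/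
theorem card_infinitePlace_eq_one_of_finrank_eq_two [IsTotallyComplex K] (h2 : Module.finrank ℚ K = 2) :
    Fintype.card (InfinitePlace K) = 1 := by
  have h := IsTotallyComplex.finrank (K := K)
  rw [card_eq_nrRealPlaces_add_nrComplexPlaces, IsTotallyComplex.nrRealPlaces_eq_zero, zero_add]
  omega

/-- In an imaginary quadratic field the infinite places form a subsingleton. [cite: NeukirchANT1999, Ch. III §1] -/
theorem subsingleton_infinitePlace_of_finrank_eq_two [IsTotallyComplex K] (h2 : Module.finrank ℚ K = 2) :
    Subsingleton (InfinitePlace K) :=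
  Fintype.card_le_one_iff_subsingleton.mp (card_infinitePlace_eq_one_of_finrank_eq_two h2).le

/-- **`|ιK(b)|² = N((b))` in an imaginary quadratic field**, for ANY complex embedding `ιK` (the product
formula at the single infinite place, of multiplicity `2`). [cite: NeukirchANT1999, Ch. III §1] -/
theorem sq_norm_embedding_eq_absNorm [IsTotallyComplex K] (h2 : Module.finrank ℚ K = 2)
    (ιK : K →+* ℂ) (b : 𝓞 K) :
    ‖ιK (b : K)‖ ^ 2 = ((Ideal.absNorm (Ideal.span {b}) : ℕ) : ℝ) := by
  haveI := subsingleton_infinitePlace_of_finrank_eq_two (K := K) h2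
  have h1 : ((Ideal.absNorm (Ideal.span {b}) : ℕ) : ℝ) = |(Algebra.norm ℚ (b : K) : ℝ)| := by
    rw [Ideal.absNorm_span_singleton, Nat.cast_natAbs, ← Algebra.coe_norm_int, Int.cast_abs]
    push_cast
    rfl
  rw [h1, ← Rat.cast_abs, ← InfinitePlace.prod_eq_abs_norm, Fintype.prod_subsingleton _ (mk ιK),
    IsTotallyComplex.mult_eq, InfinitePlace.apply]

/-- `ιK(b)·conj ιK(b) = N((b))` in an imaginary quadratic field. [cite: NeukirchANT1999, Ch. III §1] -/
theorem embedding_mul_conj_eq_absNorm [IsTotallyComplex K] (h2 : Module.finrank ℚ K = 2)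
    (ιK : K →+* ℂ) (b : 𝓞 K) :
    ιK (b : K) * conj (ιK (b : K)) = ((Ideal.absNorm (Ideal.span {b}) : ℕ) : ℂ) := by
  rw [Complex.mul_conj, Complex.normSq_eq_norm_sq, sq_norm_embedding_eq_absNorm h2 ιK b]
  norm_cast

/-! ### §2. The weight-one norm relation `ψ̃(𝔞)·conj ψ̃(𝔞) = N𝔞` -/

section WeightOne

variable [IsTotallyComplex K] {𝔪 : Ideal (𝓞 K)} {ψ : HeightOneSpectrum (𝓞 K) → ℂ}

/-- ★ **`‖φ(𝔞)‖² = N𝔞` for a Größencharakter `φ` of type `(1, 0)` of an imaginary quadratic field**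
(`φ((α)) = α` on the ray mod `𝔪`; `𝔞 ≠ 0` prime to `𝔪`): some `𝔞^m` is `(b/c)` on the ray, so
`φ(𝔞)^m = ιK(b)/ιK(c)` and `|ιK(b)|²/|ιK(c)|² = N((b))/N((c)) = N𝔞^m`.
[cite: deShalit1987, II.1.1 (p. 32–33)] [cite: NeukirchANT1999, Ch. VII §6 Prop. (6.13)] -/
theorem sq_norm_idealPow_eq_absNorm (h2 : Module.finrank ℚ K = 2) (ιK : K →+* ℂ) (h𝔪 : 𝔪 ≠ ⊥)
    (hψ0 : ∀ v : HeightOneSpectrum (𝓞 K), ¬ 𝔪 ≤ v.asIdeal → ψ v ≠ 0)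
    (hψ : ∀ b c : 𝓞 K, b ≠ 0 → c ≠ 0 → IsCoprime (Ideal.span {c}) 𝔪 → b - c ∈ 𝔪 →
      idealPow K ψ (Ideal.span {b}) * ιK c = idealPow K ψ (Ideal.span {c}) * ιK b)
    {𝔞 : Ideal (𝓞 K)} (h𝔞 : 𝔞 ≠ ⊥) (hcop : IsCoprime 𝔞 𝔪) :
    ‖idealPow K ψ 𝔞‖ ^ 2 = ((Ideal.absNorm 𝔞 : ℕ) : ℝ) := by
  obtain ⟨m, hm, b, c, hb, hc, hccop, hbc, -, heq⟩ :=
    HeckeCharacter.exists_pos_rayClassRel_top_pow h𝔪 h𝔞 hcop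
  -- `ψ̃(𝔞)^m · ιK c = ιK b`
  have hval := idealPow_eq_mul_of_span_mul_eq ιK hψ0 hψ (𝔠 := ⊤) (by simp) hb hc hccop hbc heq
  rw [idealPow_top, one_mul, idealPow_pow ψ h𝔞] at hval
  -- norms of ideals: `N(c)·N𝔞^m = N(b)`
  have hN : (Ideal.absNorm (Ideal.span {c}) : ℕ) * Ideal.absNorm 𝔞 ^ m = Ideal.absNorm (Ideal.span {b}) := by
    have := congrArg Ideal.absNorm heq
    simpa [map_mul, map_pow, Ideal.absNorm_top] using this
  have hNR : ((Ideal.absNorm (Ideal.span {c}) : ℕ) : ℝ) * ((Ideal.absNorm 𝔞 : ℕ) : ℝ) ^ m =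
      ((Ideal.absNorm (Ideal.span {b}) : ℕ) : ℝ) := by exact_mod_cast hN
  -- norms of the values: `‖ψ̃𝔞‖^{2m}·|ιK c|² = |ιK b|²`
  have hv : (‖idealPow K ψ 𝔞‖ ^ 2) ^ m * ‖ιK (c : K)‖ ^ 2 = ‖ιK (b : K)‖ ^ 2 := by
    have := congrArg (fun z : ℂ ↦ ‖z‖ ^ 2) hval
    simp only [norm_mul, norm_pow] at this
    rw [← this]; ring
  rw [sq_norm_embedding_eq_absNorm h2 ιK c, sq_norm_embedding_eq_absNorm h2 ιK b, ← hNR,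
    mul_comm] at hv
  have hc0 : ((Ideal.absNorm (Ideal.span {c}) : ℕ) : ℝ) ≠ 0 := by
    have : Ideal.absNorm (Ideal.span {c}) ≠ 0 := by
      rw [Ne, Ideal.absNorm_eq_zero_iff, Ideal.span_singleton_eq_bot]; exact hc
    exact_mod_cast this
  have hpow : (‖idealPow K ψ 𝔞‖ ^ 2) ^ m = (((Ideal.absNorm 𝔞 : ℕ) : ℝ)) ^ m :=
    mul_left_cancel₀ hc0 hv
  exact (pow_left_inj₀ (sq_nonneg _) (Nat.cast_nonneg _) hm.ne').mp hpow

/-- ★ **`φ(𝔞)·φ̄(𝔞) = N𝔞`** (de Shalit's `φ φ̄ = N` for a character of type `(1,0)`), for `𝔞 ≠ 0` prime to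
`𝔪`. [cite: deShalit1987, II.1.1 (p. 32–33)] -/
theorem idealPow_mul_conj_eq_absNorm (h2 : Module.finrank ℚ K = 2) (ιK : K →+* ℂ) (h𝔪 : 𝔪 ≠ ⊥)
    (hψ0 : ∀ v : HeightOneSpectrum (𝓞 K), ¬ 𝔪 ≤ v.asIdeal → ψ v ≠ 0)
    (hψ : ∀ b c : 𝓞 K, b ≠ 0 → c ≠ 0 → IsCoprime (Ideal.span {c}) 𝔪 → b - c ∈ 𝔪 →
      idealPow K ψ (Ideal.span {b}) * ιK c = idealPow K ψ (Ideal.span {c}) * ιK b)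
    {𝔞 : Ideal (𝓞 K)} (h𝔞 : 𝔞 ≠ ⊥) (hcop : IsCoprime 𝔞 𝔪) :
    idealPow K ψ 𝔞 * conj (idealPow K ψ 𝔞) = ((Ideal.absNorm 𝔞 : ℕ) : ℂ) := by
  rw [Complex.mul_conj, Complex.normSq_eq_norm_sq, sq_norm_idealPow_eq_absNorm h2 ιK h𝔪 hψ0 hψ h𝔞 hcop]
  norm_cast

/-- **`φ̄(𝔞) = N𝔞/φ(𝔞)`**: the conjugate value is the norm over the value (`𝔞 ≠ 0` prime to `𝔪`), so
`φ̄(𝔞)^k N𝔞^{−k} = φ(𝔞)^{−k}` — the translation between de Shalit's `L(φ̄^k, k; 𝔠)` and the lattice sums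
`Σ φ(𝔞)^{−k}`. [cite: deShalit1987, II.3.5 (13)] -/
theorem conj_idealPow_eq_absNorm_div (h2 : Module.finrank ℚ K = 2) (ιK : K →+* ℂ) (h𝔪 : 𝔪 ≠ ⊥)
    (hψ0 : ∀ v : HeightOneSpectrum (𝓞 K), ¬ 𝔪 ≤ v.asIdeal → ψ v ≠ 0)
    (hψ : ∀ b c : 𝓞 K, b ≠ 0 → c ≠ 0 → IsCoprime (Ideal.span {c}) 𝔪 → b - c ∈ 𝔪 →
      idealPow K ψ (Ideal.span {b}) * ιK c = idealPow K ψ (Ideal.span {c}) * ιK b)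
    {𝔞 : Ideal (𝓞 K)} (h𝔞 : 𝔞 ≠ ⊥) (hcop : IsCoprime 𝔞 𝔪) :
    conj (idealPow K ψ 𝔞) = ((Ideal.absNorm 𝔞 : ℕ) : ℂ) / idealPow K ψ 𝔞 := by
  have hne : idealPow K ψ 𝔞 ≠ 0 := idealPow_ne_zero_of_isCoprime hψ0 h𝔞 hcop
  rw [eq_div_iff hne, mul_comm]
  exact idealPow_mul_conj_eq_absNorm h2 ιK h𝔪 hψ0 hψ h𝔞 hcop

/-- `φ̄(𝔞)^j·φ(𝔞)^{−k} = N𝔞^j·φ(𝔞)^{−(j+k)}` (the coefficient of `L(φ̄^{k+j}, k; 𝔠)` in II.3.5 (13) read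
on the lattice sums of `EisensteinKroneckerNumbersPartialHeckeL`). [cite: deShalit1987, II.3.5 (13)] -/
theorem conj_idealPow_pow_mul_inv_pow (h2 : Module.finrank ℚ K = 2) (ιK : K →+* ℂ) (h𝔪 : 𝔪 ≠ ⊥)
    (hψ0 : ∀ v : HeightOneSpectrum (𝓞 K), ¬ 𝔪 ≤ v.asIdeal → ψ v ≠ 0)
    (hψ : ∀ b c : 𝓞 K, b ≠ 0 → c ≠ 0 → IsCoprime (Ideal.span {c}) 𝔪 → b - c ∈ 𝔪 →
      idealPow K ψ (Ideal.span {b}) * ιK c = idealPow K ψ (Ideal.span {c}) * ιK b)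
    {𝔞 : Ideal (𝓞 K)} (h𝔞 : 𝔞 ≠ ⊥) (hcop : IsCoprime 𝔞 𝔪) (j k : ℕ) :
    conj (idealPow K ψ 𝔞) ^ j * (idealPow K ψ 𝔞 ^ k)⁻¹ =
      ((Ideal.absNorm 𝔞 : ℕ) : ℂ) ^ j * (idealPow K ψ 𝔞 ^ (j + k))⁻¹ := by
  have hne : idealPow K ψ 𝔞 ≠ 0 := idealPow_ne_zero_of_isCoprime hψ0 h𝔞 hcop
  rw [conj_idealPow_eq_absNorm_div h2 ιK h𝔪 hψ0 hψ h𝔞 hcop, div_pow, pow_add]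
  field_simp

/-- **`‖φ(𝔞)‖ = √N𝔞`**: the values of `φ` grow like `N𝔞^{1/2}` (so `Σ φ(𝔞)^{−k}` converges absolutely
exactly for `k ≥ 3`). [cite: deShalit1987, II.1.1 (p. 32–33)] -/
theorem norm_idealPow_eq_sqrt_absNorm (h2 : Module.finrank ℚ K = 2) (ιK : K →+* ℂ) (h𝔪 : 𝔪 ≠ ⊥)
    (hψ0 : ∀ v : HeightOneSpectrum (𝓞 K), ¬ 𝔪 ≤ v.asIdeal → ψ v ≠ 0)
    (hψ : ∀ b c : 𝓞 K, b ≠ 0 → c ≠ 0 → IsCoprime (Ideal.span {c}) 𝔪 → b - c ∈ 𝔪 →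
      idealPow K ψ (Ideal.span {b}) * ιK c = idealPow K ψ (Ideal.span {c}) * ιK b)
    {𝔞 : Ideal (𝓞 K)} (h𝔞 : 𝔞 ≠ ⊥) (hcop : IsCoprime 𝔞 𝔪) :
    ‖idealPow K ψ 𝔞‖ = Real.sqrt ((Ideal.absNorm 𝔞 : ℕ) : ℝ) := by
  rw [← sq_norm_idealPow_eq_absNorm h2 ιK h𝔪 hψ0 hψ h𝔞 hcop, Real.sqrt_sq (norm_nonneg _)]

end WeightOne

end Literature.NumberTheory.LFunctions

end
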